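import Summits.QuantumFields.YangMills.Theorems.BalabanUVNodesN15KingModelAnalyticCauchy
import Summits.QuantumFields.YangMills.Theorems.BalabanUVNodesN15KingModelAnalyticSharp
import HarnessLib

/-!
# BalabanUVNodes ∕ N15 — THE KING-MODEL RUNG (PART Ϩ-k): THE ANALYTICITY PACKAGE OF KING's ONE-LEVEL BACKGROUND PROPAGATOR, BY NAME — [B9] Theorem 3.4's shape on the small-curvature class
# (radius `s₀η`, invertibility, `η`-uniform bounds and decay of the continued propagator, holomorphy of print's map on the polydisc, `η`-uniform Lipschitz with decay), and WHAT THE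
# COMPLEXIFICATION ADDS (two-sided first-order vs slice second-order defect; the radius is `Θ(η)`; coercivity is open on Bałaban's scale)
# (Track A, DAG node N15 = NE2; FAN-OUT v1.1 §N15 s3 «KING-MODEL RUNG … + what the curved case adds»; count-neutral)

HONEST FRAMING.  Count-neutral (cell `pub-ymgap`, seat `pub-ymgap-dag-n15-e` g51; `--supports stmt-QuantumFields-27247 --as helper` = K3ᴬ, KEY MAP v3).  Conjunctions of PART Ϩ-c∕f∕g∕h∕i∕j
theorems, by name, `𝕜 = ℂ`.  King's one-level comparison model (fine torus, King's scaling `c = L²`, Bałaban's one-level covariant block mean along the comb); `ℓ²`-Combes–Thomas prefactors;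
NOT Bałaban's multi-level `G_k(U)` (3.15) nor the random-walk expansion (3.47)–(3.57); NOT a node discharge (N15 of record untouched); nothing continuum ∕ ℝ⁴ ∕ OS ∕ Clay.

THE RESULTS: ★★★★ **`king_B9_thm34_package`** (small-curvature class, comb, `L ≥ 2`, `a, m² ≥ 0`, `κ₀ = m² + min(a,(2(d+1))⁻¹) − (d+1)d²ε₀² > 0`, `s₀ = sliceRadius κ₀ a d`: (1) every complex `U` with
`‖U_b − U₀_b‖ ≤ ε`, `Lε ≤ s₀`: `A(U,U⁻¹)` invertible ∧ `‖G(U,U⁻¹)‖ ≤ 4∕κ₀` ∧ decay `(8∕κ₀)e^{−ctRate(κ₀∕2,a,d)d∕L}`; (2) print's map `U ↦ G(U,U⁻¹)` analytic on the open polydisc `‖U_b − U₀_b‖ < s₀∕L`;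
(3) unitary `U₁` with `‖U₁ − U₀‖ ≤ ε`, `0 < ε`, `2Lε ≤ s₀`: `‖blk(A₀(U₁)⁻¹ − A₀(U₀)⁻¹) x y‖ ≤ (16∕κ₀)(Lε∕s₀)e^{−ctRate(κ₀∕2,a,d)d∕L}` — all constants functions of `(m²,a,d,ε₀)`);
★★★ **`king_B9_thm34_what_the_complexification_adds`** (by name: (a) the zeroth-order defect is first order for two-sided perturbations (`≤ ‖δU‖ + ‖δV‖`) but SECOND order on print's slice
(`≤ ε²∕(1−ε)`) and on the unitary slice (`= −(U−U₀)(U−U₀)ᴴ`); (b) the slice radius is `Θ(η)`: fails at `3√m²∕L` (fine layer), works at `s₀(m²,0,d)∕L`; (c) coercivity is open: a unitary `U`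
within `ε` of a `κ`-coercive `U₀` has `A₀(U)` `(κ∕2 − 3(d+1)(Lε)² − a((1+ε)^{2D}−1))`-coercive).
PRIOR TREE ART (by name): Ϩ-g (`king_B9_thm34_shape_small_curvature`, `sliceRadius`, `sliceRadius_pos`), Ϩ-h (`analyticOnNhd_printMap_polydisc`), Ϩ-i (`norm_blk_fullOpU_inv_sub_le_small_curvature`),
Ϩ-c (`norm_zeroth_two_sided_le`, `zeroth_unitary_slice`), Ϩ-f (`norm_slice_zeroth_le`, `re_quadForm_fullOpU_ge_of_near_unitary`), Ϩ-j (`slice_radius_sharp_order`, `slice_radius_works_free`),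
Ϥ-o (`re_quadForm_fullOpU_ge_uniform_of_small_curvature`), Ϥ-b (`kingComb`, `kingComb_depth_le`).  Dedup (rg at filing): basename 0 files; needles `king_B9_thm34_package|what_the_complexification_adds` 0 tree files.
Locators: [Balaban1985BackgroundPropagators] Thm 3.4 p.400, §3.B p.399 l.37–40, Thm 3.1 p.397, (3.35) p.396, (3.48)–(3.53) pp.398–400, (3.57) p.401; [King1986] (4.33)–(4.34) p.674.  0 `sorry`, 0 `def`.
-/

noncomputable section
open scoped BigOperators ComplexConjugate ComplexOrder Topology Matrix.Norms.L2Operator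
open Finset Matrix

namespace Summit.QuantumFields.YangMills.BalabanUVNodes.N15KingModelRung.Analytic

open Literature.MathematicalPhysics.QuantumFieldTheory.LatticeDiamagneticInequality (blk)
open Literature.MathematicalPhysics.QuantumFieldTheory.Balaban1983to89.B5Prop11Plancherel (Tor fine unitVec)
open Literature.MathematicalPhysics.QuantumFieldTheory.King1986.Torus (tdistT)
open Summit.QuantumFields.YangMills.BalabanUVNodes.N15KingModelRung.Covariant (fib)
open Summit.QuantumFields.YangMills.BalabanUVNodes.N15KingModelRung.CovariantBlock (BlockTree kingComb kingComb_depth_le fullOpU re_quadForm_fullOpU_ge_uniform_of_small_curvature)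
open Summit.QuantumFields.YangMills.BalabanUVNodes.N15KingModelRung.CombesThomas (ctRate)
open Summit.QuantumFields.YangMills.BalabanUVNodes.N15KingModelRung.Cover (kingPlaq)

variable {d : ℕ} {L : ℕ} [NeZero L] (M : Fin (d + 1) → ℕ) [hM : ∀ μ, NeZero (M μ)]
variable {n : Type*} [Fintype n] [DecidableEq n]

/-- ★★★★ **THE ANALYTICITY PACKAGE — [B9] THEOREM 3.4's SHAPE ON THE SMALL-CURVATURE CLASS, BY NAME** (comb, `L ≥ 2`, `a, m² ≥ 0`, `κ₀ > 0`, unitary `U₀` with `‖P_{U₀} − 1‖ ≤ ε₀∕L²`;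
`s₀ = sliceRadius κ₀ a d`): (1) THE WINDOW: every complex `U` in the closed polydisc `‖U_b − U₀_b‖ ≤ ε`, `Lε ≤ s₀` has `A(U,U⁻¹)` invertible, `‖G(U,U⁻¹)‖ ≤ 4∕κ₀`,
`‖blk G(U,U⁻¹) x y‖ ≤ (8∕κ₀)e^{−ctRate(κ₀∕2,a,d)d(x,y)∕L}`; (2) HOLOMORPHY: `U ↦ G(U,U⁻¹)` is analytic on the open polydisc `‖U_b − U₀_b‖ < s₀∕L`; (3) `η`-UNIFORM LIPSCHITZ WITH DECAY: unitary `U₁` with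
`‖U₁_b − U₀_b‖ ≤ ε`, `0 < ε`, `2Lε ≤ s₀` ⟹ `‖blk(A₀(U₁)⁻¹ − A₀(U₀)⁻¹) x y‖ ≤ (16∕κ₀)(Lε∕s₀)e^{−ctRate(κ₀∕2,a,d)d(x,y)∕L}`.  Radius and constants are functions of `(m²,a,d,ε₀)` only.
[cite: Balaban1985BackgroundPropagators, Thm 3.4 p.400, Thm 3.1 p.397, (3.35) p.396, (3.48)–(3.53) pp.398–400; King1986, (4.33) p.674] -/
theorem king_B9_thm34_package (hL : 2 ≤ L) {a m2 : ℝ} (ha : 0 ≤ a) (hm : 0 ≤ m2) {U₀ : Tor (fine L M) × Fin (d + 1) → Matrix n n ℂ} (hU₀ : ∀ bd, U₀ bd ∈ Matrix.unitaryGroup n ℂ)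
    {ε₀ : ℝ} (hP : ∀ (x : Tor (fine L M)) (κ ρ : Fin (d + 1)), ‖kingPlaq (fine L M) U₀ x κ ρ - 1‖ ≤ ε₀ / (L : ℝ) ^ 2)
    (hκ₀ : 0 < m2 + min a (1 / (2 * ((d : ℝ) + 1))) - ((d : ℝ) + 1) * (d : ℝ) ^ 2 * ε₀ ^ 2) :
    (∀ (U : Tor (fine L M) × Fin (d + 1) → Matrix n n ℂ) (ε : ℝ), 0 ≤ ε → (∀ bd, ‖U bd - U₀ bd‖ ≤ ε) →
        (L : ℝ) * ε ≤ sliceRadius (m2 + min a (1 / (2 * ((d : ℝ) + 1))) - ((d : ℝ) + 1) * (d : ℝ) ^ 2 * ε₀ ^ 2) a d →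
          IsUnit (cxFullOp (kingComb d L) M a ((L : ℝ) ^ 2) m2 U (fun bd => (U bd)⁻¹))
          ∧ ‖(cxFullOp (kingComb d L) M a ((L : ℝ) ^ 2) m2 U (fun bd => (U bd)⁻¹))⁻¹‖ ≤ 4 / (m2 + min a (1 / (2 * ((d : ℝ) + 1))) - ((d : ℝ) + 1) * (d : ℝ) ^ 2 * ε₀ ^ 2)
          ∧ ∀ x y : Tor (fine L M), ‖blk (cxFullOp (kingComb d L) M a ((L : ℝ) ^ 2) m2 U (fun bd => (U bd)⁻¹))⁻¹ x y‖
              ≤ 8 / (m2 + min a (1 / (2 * ((d : ℝ) + 1))) - ((d : ℝ) + 1) * (d : ℝ) ^ 2 * ε₀ ^ 2)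
                * Real.exp (-(ctRate ((m2 + min a (1 / (2 * ((d : ℝ) + 1))) - ((d : ℝ) + 1) * (d : ℝ) ^ 2 * ε₀ ^ 2) / 2) a d / L * tdistT (fine L M) x y)))
    ∧ AnalyticOnNhd ℂ (fun W : Tor (fine L M) × Fin (d + 1) → Matrix n n ℂ => (cxFullOp (kingComb d L) M a ((L : ℝ) ^ 2) m2 W (fun bd => (W bd)⁻¹))⁻¹)
        {U | ∀ bd, ‖U bd - U₀ bd‖ < sliceRadius (m2 + min a (1 / (2 * ((d : ℝ) + 1))) - ((d : ℝ) + 1) * (d : ℝ) ^ 2 * ε₀ ^ 2) a d / L}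
    ∧ (∀ (U₁ : Tor (fine L M) × Fin (d + 1) → Matrix n n ℂ), (∀ bd, U₁ bd ∈ Matrix.unitaryGroup n ℂ) → ∀ (ε : ℝ), 0 < ε → (∀ bd, ‖U₁ bd - U₀ bd‖ ≤ ε) →
        2 * ((L : ℝ) * ε) ≤ sliceRadius (m2 + min a (1 / (2 * ((d : ℝ) + 1))) - ((d : ℝ) + 1) * (d : ℝ) ^ 2 * ε₀ ^ 2) a d →
          ∀ x y : Tor (fine L M), ‖blk ((fullOpU (kingComb d L) M a ((L : ℝ) ^ 2) m2 U₁)⁻¹ - (fullOpU (kingComb d L) M a ((L : ℝ) ^ 2) m2 U₀)⁻¹) x y‖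
            ≤ 16 / (m2 + min a (1 / (2 * ((d : ℝ) + 1))) - ((d : ℝ) + 1) * (d : ℝ) ^ 2 * ε₀ ^ 2)
              * ((L : ℝ) * ε / sliceRadius (m2 + min a (1 / (2 * ((d : ℝ) + 1))) - ((d : ℝ) + 1) * (d : ℝ) ^ 2 * ε₀ ^ 2) a d)
              * Real.exp (-(ctRate ((m2 + min a (1 / (2 * ((d : ℝ) + 1))) - ((d : ℝ) + 1) * (d : ℝ) ^ 2 * ε₀ ^ 2) / 2) a d / L * tdistT (fine L M) x y))) :=
  ⟨fun _ _ hε0 hU hrad => king_B9_thm34_shape_small_curvature M hL ha hm hU₀ hP hκ₀ hε0 hU hrad,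
    analyticOnNhd_printMap_polydisc (kingComb d L) M (kingComb_depth_le (d := d) (L := L)) ha hm (by omega) hU₀ hκ₀ (re_quadForm_fullOpU_ge_uniform_of_small_curvature M hL a m2 hU₀ hP),
    fun _ hU₁ _ hε hU h2 x y => norm_blk_fullOpU_inv_sub_le_small_curvature M hL ha hm hU₀ hU₁ hP hκ₀ hε hU h2 x y⟩

/-- ★★★ **WHAT THE COMPLEXIFICATION ADDS, BY NAME**: (a) THE DEFECT: for a unitary `a` and ANY `D₁, D₂`, `‖D₁aᴴ + aD₂‖ ≤ ‖D₁‖ + ‖D₂‖` (two-sided: FIRST order — Ϛ-d's sharp `O(η²)` window),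
while on print's slice `‖(u−a)aᴴ + a(u⁻¹−aᴴ)‖ ≤ ε²∕(1−ε)` and on the unitary slice `(U−U₀)U₀ᴴ + U₀(Uᴴ−U₀ᴴ) = −(U−U₀)(U−U₀)ᴴ` (SECOND order — Bałaban's scale); (b) THE RADIUS IS `Θ(η)`
(`a = 0`, `c = L²`, `0 < m² ≤ 2(d+1)L²`, nonempty fibre): a complex field within `3√m²∕L` of `1` with `A(U,U⁻¹)` singular EXISTS, while every field within `s₀(m²,0,d)∕L` of `1` works;
(c) COERCIVITY IS OPEN on Bałaban's scale: a UNITARY `U` within `ε` of a `κ`-coercive unitary `U₀` has `(κ∕2 − 3(d+1)(Lε)² − a((1+ε)^{2D}−1))Σ‖ω_x‖² ≤ Re⟨ω,A₀(U)ω⟩` (any real `κ`).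
[cite: Balaban1985BackgroundPropagators, Thm 3.4 p.400, §3.B p.399 l.37–40, Thm 3.1 p.397, (3.48)–(3.50) pp.398–400] -/
theorem king_B9_thm34_what_the_complexification_adds [Nonempty n] (T : BlockTree d L) {D : ℕ} (hD : ∀ j, T.depth j ≤ D) (hDc : ∀ j, T.depth j ≤ (d + 1) * (L - 1))
    (hL : 1 ≤ L) {a m2 : ℝ} (ha : 0 ≤ a) (hm : 0 < m2) (hmL : m2 ≤ 2 * ((d : ℝ) + 1) * (L : ℝ) ^ 2) :
    (∀ {u₀ : Matrix n n ℂ}, u₀ ∈ Matrix.unitaryGroup n ℂ → ∀ D₁ D₂ : Matrix n n ℂ, ‖D₁ * u₀ᴴ + u₀ * D₂‖ ≤ ‖D₁‖ + ‖D₂‖)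
    ∧ (∀ {u₀ u : Matrix n n ℂ}, u₀ ∈ Matrix.unitaryGroup n ℂ → ∀ {ε : ℝ}, ‖u - u₀‖ ≤ ε → ε < 1 → ‖(u - u₀) * u₀ᴴ + u₀ * (u⁻¹ - u₀ᴴ)‖ ≤ ε ^ 2 / (1 - ε))
    ∧ (∀ {u u₀ : Matrix n n ℂ}, u ∈ Matrix.unitaryGroup n ℂ → u₀ ∈ Matrix.unitaryGroup n ℂ → (u - u₀) * u₀ᴴ + u₀ * (uᴴ - u₀ᴴ) = -((u - u₀) * (u - u₀)ᴴ))
    ∧ (∃ U : Tor (fine L M) × Fin (d + 1) → Matrix n n ℂ, (∀ bd, ‖U bd - 1‖ ≤ 3 * Real.sqrt m2 / L) ∧ ¬ IsUnit (cxFullOp T M 0 ((L : ℝ) ^ 2) m2 U (fun bd => (U bd)⁻¹)))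
    ∧ (∀ (U : Tor (fine L M) × Fin (d + 1) → Matrix n n ℂ) (ε : ℝ), 0 ≤ ε → (∀ bd, ‖U bd - 1‖ ≤ ε) → (L : ℝ) * ε ≤ sliceRadius m2 0 d →
        IsUnit (cxFullOp T M 0 ((L : ℝ) ^ 2) m2 U (fun bd => (U bd)⁻¹)))
    ∧ (∀ (U₀ U : Tor (fine L M) × Fin (d + 1) → Matrix n n ℂ), (∀ bd, U₀ bd ∈ Matrix.unitaryGroup n ℂ) → (∀ bd, U bd ∈ Matrix.unitaryGroup n ℂ) →
        ∀ {κ : ℝ}, (∀ v : Tor (fine L M) × n → ℂ, κ * ∑ x, ‖fib (fine L M) v x‖ ^ 2 ≤ RCLike.re (star v ⬝ᵥ (fullOpU T M a ((L : ℝ) ^ 2) m2 U₀ *ᵥ v))) →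
          ∀ {ε : ℝ}, 0 ≤ ε → (∀ bd, ‖U bd - U₀ bd‖ ≤ ε) → ∀ ω : Tor (fine L M) × n → ℂ,
            (κ / 2 - 3 * ((d : ℝ) + 1) * ((L : ℝ) * ε) ^ 2 - a * ((1 + ε) ^ (2 * D) - 1)) * ∑ x, ‖fib (fine L M) ω x‖ ^ 2
              ≤ RCLike.re (star ω ⬝ᵥ (fullOpU T M a ((L : ℝ) ^ 2) m2 U *ᵥ ω))) :=
  ⟨fun hu₀ D₁ D₂ => norm_zeroth_two_sided_le hu₀ D₁ D₂,
    fun hu₀ _ hu hε => norm_slice_zeroth_le hu₀ hu hε,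
    fun hu hu₀ => zeroth_unitary_slice hu hu₀,
    slice_radius_sharp_order T M hL hm hmL,
    fun _ _ hε0 hU hrad => (slice_radius_works_free T M hDc hL hm hε0 hU hrad).1,
    fun _ _ hU₀ hUu _ hcoer _ hε0 hU ω => re_quadForm_fullOpU_ge_of_near_unitary T M hD ha hm.le hL hU₀ hcoer hUu hε0 hU ω⟩

end Summit.QuantumFields.YangMills.BalabanUVNodes.N15KingModelRung.Analytic

end
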